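import Summits.Langlands.Langlands.Theses.IrreducibilityBySelfDuality
import Summits.Langlands.Langlands.Theorems.IrreducibilityBySelfDualityIrreducibleGL3CMContinuousSemisimplification
import Summits.Langlands.Langlands.Theorems.IrreducibilityBySelfDualityIrreducibleGL3CMReducibleCompanion
import Literature.RepresentationTheory.Semisimple.SubrepresentationEquiv

/-!
# `ReciprocityUpToIrreducibility` (item stmt-Langlands-14328, support r9 of route
`IrreducibilityBySelfDuality`): its exact position relative to the summit

The item `E := ReciprocityUpToIrreducibility` is "the rest of the mountain": for every number field
`F` ONE reciprocity datum `Rec` such that for every `n ≥ 1` and level witness `hcpt`, (A') every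
L-algebraic cuspidal `π` of `GL_n(𝔸_F)` has, for all `ℓ`, `ι`, SOME geometric `ρ` with
`Corresponds Rec ι π ρ` (no irreducibility, no uniqueness clause), and (B) `GaloisToAutomorphic`
verbatim.  It is an OPEN PROBLEM (Buzzard–Gee 2014 Conj. 3.2.1/3.2.2 and Fontaine–Mazur–Langlands for
all `n` over all number fields).  This file does not (cannot) settle it; it certifies, sorry-free, WHERE
the item sits:

* `langlands_iff_reciprocityUpToIrreducibility_and_irreducible` — **`Langlands ↔ E ∧ I`** (in
  particular the summit implies `E`, so `E` is not refutable unless the summit is), where `I`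
  is irreducibility of EVERY `ℓ`-adic avatar Satake–Frobenius compatible almost everywhere with an
  L-algebraic cuspidal `π` (the route's `IrreducibleOffSector` with the sector exclusion deleted, i.e.
  `IrreducibleOffSector ∧` the sector case).  Direction `←` is the route's deciding argument
  (uniqueness up to conjugacy is automatic: Chebotarev + Brauer–Nesbitt); direction `→` shows the
  summit already forces `I`: a compatible avatar `ρ` has a CONTINUOUS semisimplification `r`
  (landed stub `stub_continuousSemisimplification`, any rank) with the same Frobenius polynomials,
  hence `r ≃ ρ_{π,ι}` (irreducible, from the summit) by Chebotarev + Brauer–Nesbitt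
  (`FramedGaloisRep.nonempty_equiv_of_hasFrobCharpolyAt_eventually`), so `r` is irreducible and then
  so is `ρ` (landed stub `stub_not_isIrreducible_of_charpoly_eq`).

Consequently the item carries the full weight of the summit except the statement `I`
("cuspidal ⇒ irreducible", itself open off the known sectors): settling `E` either way settles
most of `Langlands`.  No new definitions; axioms `propext`, `Classical.choice`, `Quot.sound`.
-/

noncomputable section

set_option linter.dupNamespace false -- project-wide option (lakefile weak.linter.dupNamespace); `Summit.Langlands.Langlands` is the mandated namespace

open scoped NumberField Classical
open Filter IsDedekindDomain
open Literature.NumberTheory.Automorphic Literature.NumberTheory.GaloisRepresentations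
open Summit.Langlands.Langlands.Theses.IrreducibilityBySelfDuality
open Summit.Langlands.Langlands.Theorems.IrreducibleGL3CM

namespace Summit.Langlands.Langlands.Theorems.ReciprocityUpToIrreducibility

/-- **The summit forces irreducibility of every compatible avatar.**  Under `Langlands`, for every
`n ≥ 1`, every L-algebraic cuspidal `π` of `GL_n(𝔸_K)`, every `ℓ`, `ι` and EVERY
`ρ : Γ_K → GL_n(ℚ̄_ℓ)` Satake–Frobenius compatible with `(π, ι)` at almost all places, `ρ` is
irreducible: the continuous semisimplification `r` of `ρ` is compatible as well, hence equivalent to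
the irreducible `ρ_{π,ι}` of the summit (Chebotarev + Brauer–Nesbitt), hence irreducible, and a
semisimple representation with the characteristic polynomials of a reducible one is reducible.
[folklore] -/
theorem isIrreducible_of_satakeFrobCompatible_of_langlands (h : _root_.Langlands)
    (n : ℕ) (K : Type) [Field K] [NumberField K] (hcpt : isCompact_glFiniteIntegralLevel n K)
    (hn : 0 < n) (π : CuspidalAutomorphicRepData n K hcpt) (hL : π.1.IsLAlgebraic)
    (ℓ : ℕ) [Fact ℓ.Prime] (ι : PadicAlgCl ℓ ≃+* ℂ) (ρ : FramedGaloisRep K (PadicAlgCl ℓ) n)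
    (hρ : ∀ᶠ v : HeightOneSpectrum (𝓞 K) in cofinite, SatakeFrobCompatibleAt ι π.1 ρ v) :
    ρ.toGaloisRep.IsIrreducible := by
  obtain ⟨Rec, hRec⟩ := h K
  obtain ⟨hA, -⟩ := hRec n hn hcpt
  obtain ⟨ρ₀, hirr₀, -, hcorr₀, -⟩ := hA π hL ℓ ι
  -- the continuous semisimplification of `ρ`, still compatible a.e.
  obtain ⟨r, hrss, hrcp, hrker⟩ := stub_continuousSemisimplification K ℓ n ρ
  have hs₀ : ρ₀.toGaloisRep.IsSemisimple := by
    haveI := hirr₀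
    change ComplementedLattice _
    infer_instance
  have hev : ∀ᶠ v : HeightOneSpectrum (𝓞 K) in cofinite,
      ρ₀.IsUnramifiedAt v ∧ r.IsUnramifiedAt v ∧
        ∃ P : Polynomial (PadicAlgCl ℓ), ρ₀.HasFrobCharpolyAt v P ∧ r.HasFrobCharpolyAt v P := by
    filter_upwards [hcorr₀.1, hρ] with v hv₀ hv
    obtain ⟨α₀, hα₀, hur₀, hcp₀⟩ := hv₀
    obtain ⟨α, hα, hur, hcp⟩ := hv
    obtain rfl : α = α₀ := AutomorphicRepData.hasSatakeParamAt_unique_holds π.1 hα hα₀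
    exact ⟨hur₀, fun 𝔓 h𝔓 σ hσ => hrker σ (hur 𝔓 h𝔓 σ hσ), _, hcp₀,
      fun 𝔓 h𝔓 σ hσ => (hrcp σ).trans (hcp 𝔓 h𝔓 σ hσ)⟩
  obtain ⟨e⟩ :=
    FramedGaloisRep.nonempty_equiv_of_hasFrobCharpolyAt_eventually chebotarev_artinRep_holds ρ₀ r
      hs₀ hrss hev
  have hrirr : r.toGaloisRep.IsIrreducible := by
    haveI := hirr₀
    exact Literature.RepresentationTheory.Semisimple.Representation.isIrreducible_of_equiv e.toRepEquiv
  by_contra hirr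
  exact stub_not_isIrreducible_of_charpoly_eq K ℓ n ρ r hrss hrcp hirr hrirr

/-- **`Langlands ↔ ReciprocityUpToIrreducibility ∧ (cuspidal ⇒ every compatible avatar irreducible)`.**
The summit is EQUIVALENT to the conjunction of the item `E = ReciprocityUpToIrreducibility` (stmt-Langlands-14328)
and the statement `I` that for every `n ≥ 1`, every number field `K`, every L-algebraic cuspidal `π` of
`GL_n(𝔸_K)`, every `ℓ`, `ι`, every `ρ : Γ_K → GL_n(ℚ̄_ℓ)` Satake–Frobenius compatible with `(π, ι)`
almost everywhere is irreducible (the route's `IrreducibleOffSector` without the sector exclusion).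
`→`: drop irreducibility/uniqueness from (A) and keep (B) for `E`;
`isIrreducible_of_satakeFrobCompatible_of_langlands` for `I`.  `←`: the route's deciding argument — the `ρ`
of `E` is irreducible by `I`, and unique up to conjugacy among corresponding `ρ'` because both are
irreducible (hence semisimple) with the same Frobenius polynomials a.e. (Satake parameters are unique,
`hasSatakeParamAt_unique_holds`), hence equivalent (Chebotarev + Brauer–Nesbitt,
`FramedGaloisRep.nonempty_equiv_of_hasFrobCharpolyAt_eventually`), hence conjugate
(`FramedRep.exists_eq_conj_of_equiv`). [folklore] -/
theorem langlands_iff_reciprocityUpToIrreducibility_and_irreducible :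
    _root_.Langlands ↔ ReciprocityUpToIrreducibility ∧
      ∀ (n : ℕ) (K : Type) [Field K] [NumberField K] (hcpt : isCompact_glFiniteIntegralLevel n K),
        0 < n → ∀ π : CuspidalAutomorphicRepData n K hcpt, π.1.IsLAlgebraic →
          ∀ (ℓ : ℕ) [Fact ℓ.Prime] (ι : PadicAlgCl ℓ ≃+* ℂ) (ρ : FramedGaloisRep K (PadicAlgCl ℓ) n),
            (∀ᶠ v : HeightOneSpectrum (𝓞 K) in cofinite, SatakeFrobCompatibleAt ι π.1 ρ v) →
              ρ.toGaloisRep.IsIrreducible := by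
  constructor
  · intro h
    refine ⟨fun F _ _ => ?_, fun n K _ _ hcpt hn π hL ℓ _ ι ρ hρ =>
      isIrreducible_of_satakeFrobCompatible_of_langlands h n K hcpt hn π hL ℓ ι ρ hρ⟩
    -- the summit implies the item: drop irreducibility and uniqueness from (A), keep (B)
    obtain ⟨Rec, hRec⟩ := h F
    refine ⟨Rec, fun n hn hcpt => ?_⟩
    obtain ⟨hA, hB⟩ := hRec n hn hcpt
    refine ⟨fun π hL ℓ _ ι => ?_, hB⟩
    obtain ⟨ρ, -, hgeo, hcorr, -⟩ := hA π hL ℓ ι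
    exact ⟨ρ, hgeo, hcorr⟩
  · rintro ⟨hE, hI⟩ F _ _
    obtain ⟨Rec, hRec⟩ := hE F
    refine ⟨Rec, fun n hn hcpt => ?_⟩
    obtain ⟨hA, hB⟩ := hRec n hn hcpt
    refine ⟨?_, hB⟩
    intro π hL ℓ _ ι
    have irr : ∀ ρ : FramedGaloisRep F (PadicAlgCl ℓ) n,
        (∀ᶠ v : HeightOneSpectrum (𝓞 F) in cofinite, SatakeFrobCompatibleAt ι π.1 ρ v) →
          ρ.toGaloisRep.IsIrreducible :=
      fun ρ hρ => hI n F hcpt hn π hL ℓ ι ρ hρ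
    obtain ⟨ρ, hgeo, hcorr⟩ := hA π hL ℓ ι
    refine ⟨ρ, irr ρ hcorr.1, hgeo, hcorr, fun ρ' hcorr' => ?_⟩
    have h1 : ρ.toGaloisRep.IsIrreducible := irr ρ hcorr.1
    have h2 : ρ'.toGaloisRep.IsIrreducible := irr ρ' hcorr'.1
    have hs1 : ρ.toGaloisRep.IsSemisimple := by
      haveI := h1
      change ComplementedLattice _
      infer_instance
    have hs2 : ρ'.toGaloisRep.IsSemisimple := by
      haveI := h2
      change ComplementedLattice _
      infer_instance
    have hev : ∀ᶠ v : HeightOneSpectrum (𝓞 F) in cofinite,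
        ρ.IsUnramifiedAt v ∧ ρ'.IsUnramifiedAt v ∧
          ∃ P : Polynomial (PadicAlgCl ℓ), ρ.HasFrobCharpolyAt v P ∧ ρ'.HasFrobCharpolyAt v P := by
      filter_upwards [hcorr.1, hcorr'.1] with v hv hv'
      obtain ⟨α, hα, hur, hcp⟩ := hv
      obtain ⟨α', hα', hur', hcp'⟩ := hv'
      obtain rfl : α = α' := AutomorphicRepData.hasSatakeParamAt_unique_holds π.1 hα hα'
      exact ⟨hur, hur', _, hcp, hcp'⟩
    obtain ⟨e⟩ :=
      FramedGaloisRep.nonempty_equiv_of_hasFrobCharpolyAt_eventually chebotarev_artinRep_holds ρ ρ'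
        hs1 hs2 hev
    obtain ⟨P, hP⟩ := FramedRep.exists_eq_conj_of_equiv ρ ρ' e
    exact ⟨P, hP.symm⟩

end Summit.Langlands.Langlands.Theorems.ReciprocityUpToIrreducibility

end
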